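import Summits.QuantumFields.QCD.Theorems.QuarksAsStableActionStableActionBridgeStubFockLiftComplement
import Summits.QuantumFields.QCD.Theorems.QuarksAsStableActionStableActionBridgeStubSliceDataSuConj
import Summits.QuantumFields.QCD.Theorems.QuarksAsStableActionStableActionBridgeSliceGaugeUnitarity
import Summits.QuantumFields.QCD.Theorems.QuarksAsStableActionStableActionBridgeConjTransport
import Summits.QuantumFields.QCD.Theorems.QuarksAsStableActionStableActionBridgeFermionSliceOpCovariance
import HarnessLib

/-!
# Charge conjugation of the Fock gauge rotation: `P_h Γ(G_g) P_hᴴ = Γ(G_{ḡ})`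
(stub `stub_fockGaugeAct_chargeConj` of line `twisted_trace_transfer` for crux
`QuarksAsStableAction.StableActionBridge`, item stmt-QuantumFields-9737, `--supports`; sub-goal V1 of
step E3)

Step E3 of the line realises Lüscher's transfer matrix of lattice QCD as a compact self-adjoint operator
with a parity-adapted eigenbasis; to prove that its vacuum is fermion-even the line uses CHARGE
CONJUGATION `𝒱 = P_hᴴ Γ(1 ⊗ w)` on the slice Fock space (`P_h = particleHole 1` the particle–hole map,
`w = C γ₄`, `C = chargeConj`) combined with complex conjugation `U ↦ Ū` (`suConj 3`) of the link
variables.  This file supplies the three gauge-rotation facts of that argument, for the second-quantised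
gauge action `Γ(G_g) = fockGaugeAct g = Γ(M)`, `M = reindex e e (R_c ⊗ 1)`, of a time-independent gauge
transformation `g : TorusSite 3 S → SU(3)` (Smit, *Introduction to Quantum Fields on a Lattice*, §4.6
(4.124)–(4.127); `R_c` the spin-blind colour rotation, `e = sliceQuarkEquiv`):

1. `P_h Γ(G_g) P_hᴴ = Γ(G_{ḡ})`.  By the landed particle–hole conjugation of the Fock functor
   (`StubFockLiftComplement.particleHole_one_conj_Gamma`), `P_h Γ(M) P_hᴴ = det M · Γ(M⁻ᵀ)`.  Here
   `det M = 1`: `det (R_c ⊗ 1) = (det R_c)⁴ = 1`, `R_c` being, up to a reindexing, block diagonal with the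
   `SU(3)` blocks `g(x)` (the landed `RobustYangMillsHandover.PinTheInfimum.FilledSliceState.det_sliceGaugeRot`,
   `Matrix.det_reindex_self`); and
   `M⁻ᵀ = M̄` entrywise since `M` is unitary (`M⁻¹ = Mᴴ`; `Sketch.SliceGaugeUnitarity.sliceGaugeRot_unitary`).
   Finally `Γ(M̄) = Γ(M)‾ = Γ(G_{ḡ})` (`StubSliceDataSuConj.fockLift_map_conj`, `fockGaugeAct_suConj`).
2. `Γ(1 ⊗ w) Γ(G_g) = Γ(G_g) Γ(1 ⊗ w)`: `Γ = fockLift` and `reindex e e` are multiplicative, and the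
   spin-only matrix `1 ⊗ w` commutes with the spin-blind `R_c ⊗ 1`
   (`Sketch.sliceKron_one_mul_sliceGaugeRot_comm`).
3. `(P_hᴴ Γ(X))_{s t} = 0` unless `#s + #t = #modes`: `P_h` is supported on complements
   (`(P_h)_{u s} = 0` unless `u = sᶜ`) and `Γ(X)` preserves the mode number (`Γ(X)_{sᶜ t} = 0` unless
   `#t = #sᶜ = #modes − #s`).

Pure theorem file (no definitions, no local notations); helpers in the sub-namespace
`StubFockGaugeActChargeConj`.

[cite: Smit2023, §4.6 (4.124)–(4.127)] [cite: LuciniEtAl2016, §6]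
-/

noncomputable section

open scoped Matrix BigOperators ComplexConjugate
open Literature.MathematicalPhysics.QuantumFieldTheory Literature.MathematicalPhysics.QuantumLattice
open Literature.Probability.LatticeModels (TorusSite)

namespace Summit.QuantumFields.QCD.Cruxes.StableActionBridge.TwistedTraceTransfer

namespace StubFockGaugeActChargeConj

open Matrix Finset
open Summit.QuantumFields.QCD.Cruxes.StableActionBridge.Sketch
open Summit.QuantumFields.QCD.Cruxes.StableActionBridge.Sketch.FockLiftPosDef

/-! ### The mode-number selection rule of `P_hᴴ Γ(X)` -/

section Selection

variable {ι : Type*} [LinearOrder ι] [Fintype ι]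

/-- **`(P_hᴴ Γ(X))_{s t} = 0` unless `#s + #t = #ι`**: the particle–hole map is supported on
complements (`(P_h)_{u s} = 0` unless `u = sᶜ`) and the second quantisation `Γ(X) = fockLift X`
preserves the mode number (`Γ(X)_{sᶜ t} = 0` unless `#t = #sᶜ = #ι − #s`). [folklore] -/
theorem particleHole_conjTranspose_mul_fockLift_apply (ε : ι → ℂ) (X : Matrix ι ι ℂ)
    {s t : Finset ι} (h : s.card + t.card ≠ Fintype.card ι) :
    ((particleHole ε)ᴴ * fockLift X) s t = 0 := by
  rw [Matrix.mul_apply]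
  refine Finset.sum_eq_zero fun u _ => ?_
  rw [Matrix.conjTranspose_apply, particleHole_apply]
  by_cases hu : u = sᶜ
  · have hc : ¬ t.card = u.card := by
      rw [hu, Finset.card_compl]
      have := Finset.card_le_univ s
      omega
    rw [fockLift, Matrix.of_apply, dif_neg hc, mul_zero]
  · rw [if_neg hu, star_zero, zero_mul]

end Selection

/-! ### Determinant and inverse transpose of the one-particle gauge rotation -/

variable {Nf S : ℕ} [NeZero S]

/-- The transported one-particle rotation `M = reindex e e (R_c ⊗ 1)` has `det M = 1`
(`det (R_c ⊗ 1) = (det R_c)⁴ = 1`, `R_c` block diagonal with `SU(3)` blocks — the landed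
`FilledSliceState.det_sliceGaugeRot`). [cite: Smit2023, §4.6 (4.124)–(4.126)] -/
theorem det_reindex_sliceGaugeRot (g : TorusSite 3 S → Matrix.specialUnitaryGroup (Fin 3) ℂ) :
    (Matrix.reindex sliceQuarkEquiv sliceQuarkEquiv (sliceGaugeRot (Nf := Nf) g)).det = 1 := by
  rw [Matrix.det_reindex_self, RobustYangMillsHandover.PinTheInfimum.FilledSliceState.det_sliceGaugeRot]

/-- `M = reindex e e (R_c ⊗ 1)` is unitary: `Mᴴ M = 1`. [cite: Smit2023, §4.6 (4.124)–(4.126)] -/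
theorem reindex_sliceGaugeRot_conjTranspose_mul_self
    (g : TorusSite 3 S → Matrix.specialUnitaryGroup (Fin 3) ℂ) :
    (Matrix.reindex sliceQuarkEquiv sliceQuarkEquiv (sliceGaugeRot (Nf := Nf) g))ᴴ *
      Matrix.reindex sliceQuarkEquiv sliceQuarkEquiv (sliceGaugeRot (Nf := Nf) g) = 1 := by
  rw [Matrix.reindex_apply]
  exact (SliceGaugeUnitarity.submatrix_equiv_conjTranspose_mul_self _ _
    (SliceGaugeUnitarity.sliceGaugeRot_unitary g)).1

/-- **`M⁻ᵀ = M̄`** for the unitary `M = reindex e e (R_c ⊗ 1)`: `M⁻¹ = Mᴴ` and `(Mᴴ)ᵀ` is the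
entrywise conjugate. [folklore] -/
theorem reindex_sliceGaugeRot_inv_transpose
    (g : TorusSite 3 S → Matrix.specialUnitaryGroup (Fin 3) ℂ) :
    ((Matrix.reindex sliceQuarkEquiv sliceQuarkEquiv (sliceGaugeRot (Nf := Nf) g))⁻¹)ᵀ =
      (Matrix.reindex sliceQuarkEquiv sliceQuarkEquiv (sliceGaugeRot (Nf := Nf) g)).map
        (starRingEnd ℂ) := by
  rw [Matrix.inv_eq_left_inv (reindex_sliceGaugeRot_conjTranspose_mul_self g),
    Matrix.conjTranspose_transpose]
  rfl

/-- `Γ(G_g) = Gamma M` with `M = reindex e e (R_c ⊗ 1)` (the tree's two Fock functors agree,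
`fockLift_eq_Gamma'`). [folklore] -/
theorem fockGaugeAct_eq_Gamma (g : TorusSite 3 S → Matrix.specialUnitaryGroup (Fin 3) ℂ) :
    fockGaugeAct (Nf := Nf) g =
      Gamma (Matrix.reindex sliceQuarkEquiv sliceQuarkEquiv (sliceGaugeRot (Nf := Nf) g)) := by
  rw [fockGaugeAct, fockLift_eq_Gamma']

/-! ### The three clauses -/

/-- **Clause (1): `P_h Γ(G_g) P_hᴴ = Γ(G_{ḡ})`** — `P_h Γ(M) P_hᴴ = det M · Γ(M⁻ᵀ)` with `det M = 1`,
`M⁻ᵀ = M̄`, and `Γ(M̄) = Γ(M)‾ = Γ(G_{ḡ})`. [cite: Smit2023, §4.6 (4.125)–(4.127)] -/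
theorem particleHole_conj_fockGaugeAct (g : TorusSite 3 S → Matrix.specialUnitaryGroup (Fin 3) ℂ) :
    particleHole (fun _ : SliceFermiIdx Nf S => (1 : ℂ)) * fockGaugeAct (Nf := Nf) g *
        (particleHole (fun _ : SliceFermiIdx Nf S => (1 : ℂ)))ᴴ =
      fockGaugeAct (Nf := Nf) (fun x => suConj 3 (g x)) := by
  rw [fockGaugeAct_eq_Gamma g,
    StubFockLiftComplement.particleHole_one_conj_Gamma
      (by rw [det_reindex_sliceGaugeRot]; exact isUnit_one),
    det_reindex_sliceGaugeRot, one_smul, reindex_sliceGaugeRot_inv_transpose, ← fockLift_eq_Gamma',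
    StubSliceDataSuConj.fockLift_map_conj, StubSliceDataSuConj.fockGaugeAct_suConj]
  rfl

/-- **Clause (2): `Γ(1 ⊗ w) Γ(G_g) = Γ(G_g) Γ(1 ⊗ w)`** for every spin matrix `w` — `Γ` and
`reindex e e` are multiplicative and `1 ⊗ w` commutes with the spin-blind `R_c ⊗ 1`.
[cite: Smit2023, §4.6 (4.124)–(4.127)] -/
theorem fockLift_spin_mul_fockGaugeAct (w : Matrix (Fin 4) (Fin 4) ℂ)
    (g : TorusSite 3 S → Matrix.specialUnitaryGroup (Fin 3) ℂ) :
    fockLift (Matrix.reindex sliceQuarkEquiv sliceQuarkEquiv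
        (sliceKron (1 : Matrix (SliceColourVar Nf S) (SliceColourVar Nf S) ℂ) w)) *
        fockGaugeAct (Nf := Nf) g =
      fockGaugeAct (Nf := Nf) g * fockLift (Matrix.reindex sliceQuarkEquiv sliceQuarkEquiv
        (sliceKron (1 : Matrix (SliceColourVar Nf S) (SliceColourVar Nf S) ℂ) w)) := by
  rw [fockGaugeAct, ← fockLift_mul, ← fockLift_mul, ← FermionSliceOpCovariance.reindex_mul_reindex,
    ← FermionSliceOpCovariance.reindex_mul_reindex, sliceKron_one_mul_sliceGaugeRot_comm]

end StubFockGaugeActChargeConj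

/-- **Sub-goal V1 (registered stub `stub_fockGaugeAct_chargeConj`): particle–hole conjugation of the
Fock gauge rotation is its charge conjugate, the spin rotation `Γ(1 ⊗ w)` (`w = C γ₄`) commutes with it,
and `𝒱 = P_hᴴ Γ(1 ⊗ w)` exchanges the mode-number sectors `n ↔ #modes − n`.**
`P_h Γ(G_g) P_hᴴ = det G_g · Γ(G_g⁻ᵀ)` (particle–hole conjugation of the Fock functor with
`P_h = particleHole 1`), `det G_g = 1` (block-diagonal `SU(3)` blocks `⊗ 1₄`), `G_g⁻ᵀ = Ḡ_g` (unitary)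
and `Γ(Ḡ_g) = Γ(G_{ḡ})`; spin and colour factors of `sliceKron` commute; `P_h` is supported on
complements and `Γ(·)` preserves `#s`. [cite: Smit2023, §4.6 (4.124)–(4.127)] -/
theorem stub_fockGaugeAct_chargeConj : ∀ (Nf S : ℕ) [NeZero S]
    (g : TorusSite 3 S → (Matrix.specialUnitaryGroup (Fin 3) ℂ)),
    particleHole (fun _ : SliceFermiIdx Nf S => (1 : ℂ)) * @fockGaugeAct Nf S _ g * (particleHole (fun _ : SliceFermiIdx Nf S => (1 : ℂ)))ᴴ =
      @fockGaugeAct Nf S _ (fun x => suConj 3 (g x)) ∧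
    fockLift (Matrix.reindex sliceQuarkEquiv sliceQuarkEquiv
        (sliceKron (1 : Matrix (SliceColourVar Nf S) (SliceColourVar Nf S) ℂ) (chargeConj * euclideanGamma 0))) *
        @fockGaugeAct Nf S _ g =
      @fockGaugeAct Nf S _ g * fockLift (Matrix.reindex sliceQuarkEquiv sliceQuarkEquiv
        (sliceKron (1 : Matrix (SliceColourVar Nf S) (SliceColourVar Nf S) ℂ) (chargeConj * euclideanGamma 0))) ∧
    ∀ s t : Finset (SliceFermiIdx Nf S), s.card + t.card ≠ Fintype.card (SliceFermiIdx Nf S) →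
      ((particleHole (fun _ : SliceFermiIdx Nf S => (1 : ℂ)))ᴴ * fockLift (Matrix.reindex sliceQuarkEquiv sliceQuarkEquiv
        (sliceKron (1 : Matrix (SliceColourVar Nf S) (SliceColourVar Nf S) ℂ) (chargeConj * euclideanGamma 0)))) s t = 0 := by
  intro Nf S _ g
  exact ⟨StubFockGaugeActChargeConj.particleHole_conj_fockGaugeAct g,
    StubFockGaugeActChargeConj.fockLift_spin_mul_fockGaugeAct _ g,
    fun s t h => StubFockGaugeActChargeConj.particleHole_conjTranspose_mul_fockLift_apply _ _ h⟩

end Summit.QuantumFields.QCD.Cruxes.StableActionBridge.TwistedTraceTransfer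

end
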